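import Summits.Langlands.Langlands.Theses.HolomorphicShadow

/-!
# Route HolomorphicShadow — Assembly

The assembly item (stmt-Langlands-14644) of the OPEN route `HolomorphicShadow`:
`ShadowModularity → ShadowConverse → SectorComplement → Langlands`.

This is literally the type of the route file's sorry-free deciding theorem
`Summit.Langlands.Langlands.Theses.HolomorphicShadow.closes` (hSM hSC hC ⟹ `Langlands`). Nothing here
proves `Langlands`: the assembly records only that the items of the route, taken together, imply the
summit by name (registry hygiene; count-neutral).
-/

set_option linter.dupNamespace false -- `Summit.Langlands.Langlands` is the mandated namespace

namespace Summit.Langlands.Langlands.Theorems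

/-- **Assembly of route HolomorphicShadow** (stmt-Langlands-14644):
`ShadowModularity → ShadowConverse → SectorComplement → Langlands`.
Proof: unfold `Assembly` and apply the route's deciding theorem `Theses.HolomorphicShadow.closes`. -/
theorem holomorphicShadow_assembly_proof :
    Summit.Langlands.Langlands.Theses.HolomorphicShadow.Assembly := by
  unfold Summit.Langlands.Langlands.Theses.HolomorphicShadow.Assembly
  exact Summit.Langlands.Langlands.Theses.HolomorphicShadow.closes

end Summit.Langlands.Langlands.Theorems
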